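import Literature.NumberTheory.DiophantineGeometry.SquarefulSumsDetMethod
import HarnessLib

/-!
# Heath-Brown's conic bound, III: primitive zeros of a nonsingular conic on a plane

Auxiliary file (theorems only, no definitions) for the proof of
`Literature.NumberTheory.DiophantineGeometry.TernaryConicPointBound` (D. R. Heath-Brown, *The density
of rational points on curves and surfaces*, Ann. of Math. 155 (2002), Corollary 2, key
`Heathbrown2002`), discharged in `TernaryConicPointBoundProofs`.

Content: the GEOMETRIC end of the determinant method for the conic `x ↦ xᵀ M x`
(`M` an integral `3 × 3` matrix with `det M ≠ 0`, symmetric where needed):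

* `dotProduct_mulVec_fin_three`: the form written out;
* `det_eq_zero_of_vanish_on_plane`: if the form vanishes identically on the plane `a·z = 0`
  (`a₂ ≠ 0`), i.e. the three coefficients of its restriction vanish, then `det M = 0`
  (Gram matrix `N M Nᵀ` of the basis `(a₂,0,-a₀), (0,a₂,-a₁), a`);
* `card_le_of_plane_two`, `card_le_of_plane`: the primitive integer zeros on a plane number `≤ 6`
  (chart `z ↦ z₀/z₁ ∈ ℚ ∪ {∞}` with fibres `± z`, image in `{∞} ∪ roots` of a non-zero quadratic);
* `card_part_le`: a set of primitive zeros any three of which are linearly dependent has `≤ 6`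
  elements.

The template is the diagonal case `Literature.NumberTheory.DiophantineGeometry.SquarefulDet.*`
(`SquarefulSumsDetMethod.lean`), whose `eq_or_eq_neg_of_parallel`, `comp_perm_injective` are reused.

## References

* D. R. Heath-Brown, Ann. of Math. 155 (2002), Corollary 2 and §3 [Heathbrown2002].
-/

namespace Literature.NumberTheory.DiophantineGeometry

namespace TernaryConic

open Finset Matrix Polynomial

/-- The ternary form `xᵀ M x` written out. [folklore] -/
theorem dotProduct_mulVec_fin_three {R : Type*} [CommRing R] (M : Matrix (Fin 3) (Fin 3) R)
    (x : Fin 3 → R) :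
    x ⬝ᵥ (M *ᵥ x) = M 0 0 * x 0 * x 0 + M 0 1 * x 0 * x 1 + M 0 2 * x 0 * x 2
      + M 1 0 * x 1 * x 0 + M 1 1 * x 1 * x 1 + M 1 2 * x 1 * x 2
      + M 2 0 * x 2 * x 0 + M 2 1 * x 2 * x 1 + M 2 2 * x 2 * x 2 := by
  simp only [dotProduct, Matrix.mulVec, Fin.sum_univ_three]
  ring

/-- Permuting the coordinates: the form of `M.submatrix σ σ` at `z ∘ σ` is the form of `M` at `z`.
[folklore] -/
theorem dotProduct_mulVec_comp_perm {R : Type*} [CommRing R] (M : Matrix (Fin 3) (Fin 3) R)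
    (z : Fin 3 → R) (σ : Equiv.Perm (Fin 3)) :
    (z ∘ σ) ⬝ᵥ ((M.submatrix σ σ) *ᵥ (z ∘ σ)) = z ⬝ᵥ (M *ᵥ z) := by
  simp only [dotProduct, Matrix.mulVec, Matrix.submatrix_apply, Function.comp_apply]
  have h : ∀ i, ∑ j, M (σ i) (σ j) * z (σ j) = ∑ j, M (σ i) j * z j :=
    fun i => Equiv.sum_comp σ (fun j => M (σ i) j * z j)
  simp_rw [h]
  exact Equiv.sum_comp σ (fun i => z i * ∑ j, M i j * z j)

/-- If the restriction of the form of the symmetric matrix `(mᵢⱼ)` to the plane `a·z = 0`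
(`a₂ ≠ 0`) vanishes identically — the three coefficients of the binary form
`Q(z₀ (a₂,0,-a₀) + z₁ (0,a₂,-a₁))` vanish — then the determinant vanishes (Gram matrix of the
basis `(a₂,0,-a₀), (0,a₂,-a₁), a`). [folklore] -/
theorem det_eq_zero_of_vanish_on_plane (m₀₀ m₀₁ m₀₂ m₁₁ m₁₂ m₂₂ : ℤ)
    (a : Fin 3 → ℤ) (ha : a 2 ≠ 0)
    (hg₀ : m₀₀ * a 2 ^ 2 - 2 * m₀₂ * a 2 * a 0 + m₂₂ * a 0 ^ 2 = 0)
    (hg₁ : m₀₁ * a 2 ^ 2 - m₀₂ * a 1 * a 2 - m₁₂ * a 0 * a 2 + m₂₂ * a 0 * a 1 = 0)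
    (hg₂ : m₁₁ * a 2 ^ 2 - 2 * m₁₂ * a 2 * a 1 + m₂₂ * a 1 ^ 2 = 0) :
    (!![m₀₀, m₀₁, m₀₂; m₀₁, m₁₁, m₁₂; m₀₂, m₁₂, m₂₂] : Matrix (Fin 3) (Fin 3) ℤ).det = 0 := by
  set S : Matrix (Fin 3) (Fin 3) ℤ := !![m₀₀, m₀₁, m₀₂; m₀₁, m₁₁, m₁₂; m₀₂, m₁₂, m₂₂] with hS
  set N : Matrix (Fin 3) (Fin 3) ℤ := !![a 2, 0, -a 0; 0, a 2, -a 1; a 0, a 1, a 2] with hN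
  have hNdet : N.det = a 2 * (a 0 ^ 2 + a 1 ^ 2 + a 2 ^ 2) := by
    rw [Matrix.det_fin_three]
    simp [hN]
    ring
  have hNdet0 : N.det ≠ 0 := by
    rw [hNdet]
    exact mul_ne_zero ha (by positivity)
  set E : Matrix (Fin 3) (Fin 3) ℤ := N * S * Nᵀ with hE
  have hEdet : E.det = N.det * S.det * N.det := by
    rw [hE, Matrix.det_mul, Matrix.det_mul, Matrix.det_transpose]
  have hexp : ∀ i j, E i j = ∑ k, (∑ l, N i l * S l k) * N j k := by
    intro i j
    simp only [hE, Matrix.mul_apply, Matrix.transpose_apply]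
  have hE00 : E 0 0 = 0 := by
    rw [hexp]
    simp only [Fin.sum_univ_three]
    simp [hN, hS]
    linear_combination hg₀
  have hE11 : E 1 1 = 0 := by
    rw [hexp]
    simp only [Fin.sum_univ_three]
    simp [hN, hS]
    linear_combination hg₂
  have hE01 : E 0 1 = 0 := by
    rw [hexp]
    simp only [Fin.sum_univ_three]
    simp [hN, hS]
    linear_combination hg₁
  have hE10 : E 1 0 = 0 := by
    rw [hexp]
    simp only [Fin.sum_univ_three]
    simp [hN, hS]
    linear_combination hg₁
  have hEdet0 : E.det = 0 := by
    rw [Matrix.det_fin_three, hE00, hE11, hE01, hE10]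
    ring
  rw [hEdet0] at hEdet
  have h : N.det * N.det * S.det = 0 := by linear_combination -hEdet
  rcases mul_eq_zero.mp h with h | h
  · exact absurd (mul_self_eq_zero.mp h) hNdet0
  · exact h

/-- On the plane `a·z = 0` with `a₂ ≠ 0`, the primitive integer zeros of `xᵀ M x` (`M` symmetric,
`det M ≠ 0`) number at most `6`: the chart `z ↦ z₀/z₁ ∈ ℚ ∪ {∞}` has fibres `{± z}` and image in
`{∞} ∪ roots` of a non-zero quadratic. [folklore] -/
theorem card_le_of_plane_two (M : Matrix (Fin 3) (Fin 3) ℤ) (hM : M.IsSymm) (hdet : M.det ≠ 0)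
    (a : Fin 3 → ℤ) (ha : a 2 ≠ 0) (T : Finset (Fin 3 → ℤ))
    (hprim : ∀ z ∈ T, ∃ b : Fin 3 → ℤ, ∑ i, b i * z i = 1)
    (hF : ∀ z ∈ T, z ⬝ᵥ (M *ᵥ z) = 0)
    (hplane : ∀ z ∈ T, ∑ i, a i * z i = 0) :
    T.card ≤ 6 := by
  classical
  have h10 : M 1 0 = M 0 1 := hM.apply 0 1
  have h20 : M 2 0 = M 0 2 := hM.apply 0 2
  have h21 : M 2 1 = M 1 2 := hM.apply 1 2
  -- the chart `z ↦ z₀/z₁`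
  let φ : (Fin 3 → ℤ) → Option ℚ := fun z => if z 1 = 0 then none else some ((z 0 : ℚ) / z 1)
  -- fibres have at most two elements
  have hfib : ∀ z ∈ T, ∀ z' ∈ T, φ z = φ z' → z' = z ∨ z' = -z := by
    intro z hz z' hz' hφ
    have hpz := hplane z hz
    have hpz' := hplane z' hz'
    simp only [Fin.sum_univ_three] at hpz hpz'
    refine SquarefulDet.eq_or_eq_neg_of_parallel (hprim z hz) (hprim z' hz') ?_ ?_ ?_
    all_goals by_cases h1 : z 1 = 0
    all_goals by_cases h1' : z' 1 = 0
    all_goals simp only [φ, h1, h1', if_true, if_false, reduceCtorEq, Option.some.injEq] at hφ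
    · rw [h1, h1']; ring
    · rw [div_eq_div_iff (by exact_mod_cast h1) (by exact_mod_cast h1')] at hφ
      exact_mod_cast (by linear_combination hφ : (z 0 : ℚ) * z' 1 = z 1 * z' 0)
    · have : a 2 * (z 0 * z' 2 - z 2 * z' 0) = 0 := by
        linear_combination z 0 * hpz' - z' 0 * hpz + (a 1 * z' 0) * h1 - (a 1 * z 0) * h1'
      rcases mul_eq_zero.mp this with h | h
      · exact absurd h ha
      · linarith
    · rw [div_eq_div_iff (by exact_mod_cast h1) (by exact_mod_cast h1')] at hφ
      have h01 : z 0 * z' 1 = z 1 * z' 0 := by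
        exact_mod_cast (by linear_combination hφ : (z 0 : ℚ) * z' 1 = z 1 * z' 0)
      have : a 2 * (z 0 * z' 2 - z 2 * z' 0) = 0 := by
        linear_combination z 0 * hpz' - z' 0 * hpz - a 1 * h01
      rcases mul_eq_zero.mp this with h | h
      · exact absurd h ha
      · linarith
    · rw [h1, h1']; ring
    · rw [div_eq_div_iff (by exact_mod_cast h1) (by exact_mod_cast h1')] at hφ
      have h01 : z 0 * z' 1 = z 1 * z' 0 := by
        exact_mod_cast (by linear_combination hφ : (z 0 : ℚ) * z' 1 = z 1 * z' 0)
      have : a 2 * (z 1 * z' 2 - z 2 * z' 1) = 0 := by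
        linear_combination z 1 * hpz' - z' 1 * hpz + a 0 * h01
      rcases mul_eq_zero.mp this with h | h
      · exact absurd h ha
      · linarith
  have hfib2 : ∀ q ∈ T.image φ, (T.filter fun z => φ z = q).card ≤ 2 := by
    intro q hq
    obtain ⟨z₀, hz₀, rfl⟩ := Finset.mem_image.mp hq
    calc (T.filter fun z => φ z = φ z₀).card ≤ ({z₀, -z₀} : Finset (Fin 3 → ℤ)).card := by
          refine Finset.card_le_card fun z hz => ?_
          rw [Finset.mem_filter] at hz
          rcases hfib z₀ hz₀ z hz.1 hz.2.symm with h | h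
          · simp [h]
          · simp [h]
      _ ≤ 2 := Finset.card_le_two
  -- the binary form on the plane
  set g₀ : ℤ := M 0 0 * a 2 ^ 2 - 2 * M 0 2 * a 2 * a 0 + M 2 2 * a 0 ^ 2 with hg₀
  set g₁ : ℤ := M 0 1 * a 2 ^ 2 - M 0 2 * a 1 * a 2 - M 1 2 * a 0 * a 2 + M 2 2 * a 0 * a 1
    with hg₁
  set g₂ : ℤ := M 1 1 * a 2 ^ 2 - 2 * M 1 2 * a 2 * a 1 + M 2 2 * a 1 ^ 2 with hg₂
  have hG : ∀ z ∈ T, g₀ * z 0 ^ 2 + 2 * g₁ * z 0 * z 1 + g₂ * z 1 ^ 2 = 0 := by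
    intro z hz
    have hQ := hF z hz
    rw [dotProduct_mulVec_fin_three, h10, h20, h21] at hQ
    have hp := hplane z hz
    simp only [Fin.sum_univ_three] at hp
    rw [hg₀, hg₁, hg₂]
    linear_combination (a 2 ^ 2) * hQ
      - (2 * M 0 2 * a 2 * z 0 + 2 * M 1 2 * a 2 * z 1
          + M 2 2 * (-(a 0) * z 0 - a 1 * z 1 + a 2 * z 2)) * hp
  -- the polynomial
  set P : ℚ[X] := C (g₀ : ℚ) * X ^ 2 + C (2 * (g₁ : ℚ)) * X + C (g₂ : ℚ) with hP
  have hP0 : P ≠ 0 := by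
    intro hP0
    have c2' : g₀ = 0 := by
      have h := congrArg (fun P => P.coeff 2) hP0
      simp only [hP, coeff_add, coeff_C_mul_X_pow, coeff_C_mul_X, coeff_C, coeff_zero] at h
      norm_num at h
      exact_mod_cast h
    have c1' : g₁ = 0 := by
      have h := congrArg (fun P => P.coeff 1) hP0
      simp only [hP, coeff_add, coeff_C_mul_X_pow, coeff_C_mul_X, coeff_C, coeff_zero] at h
      norm_num at h
      exact_mod_cast h
    have c0' : g₂ = 0 := by
      have h := congrArg (fun P => P.coeff 0) hP0
      simp only [hP, coeff_add, coeff_C_mul_X_pow, coeff_C_mul_X, coeff_C, coeff_zero] at h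
      norm_num at h
      exact_mod_cast h
    apply hdet
    have hMS : M = !![M 0 0, M 0 1, M 0 2; M 0 1, M 1 1, M 1 2; M 0 2, M 1 2, M 2 2] := by
      ext i j
      fin_cases i <;> fin_cases j <;> simp [h10, h20, h21]
    rw [hMS]
    exact det_eq_zero_of_vanish_on_plane _ _ _ _ _ _ a ha (by rw [← c2']) (by rw [← c1'])
      (by rw [← c0'])
  have hdeg : P.natDegree ≤ 2 := by
    rw [hP]
    exact natDegree_quadratic_le
  have himage : T.image φ ⊆ insert none (P.roots.toFinset.image some) := by
    intro q hq
    obtain ⟨z, hz, rfl⟩ := Finset.mem_image.mp hq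
    by_cases h1 : z 1 = 0
    · simp [φ, h1]
    · simp only [φ, h1, if_false]
      refine Finset.mem_insert_of_mem (Finset.mem_image_of_mem _ ?_)
      rw [Multiset.mem_toFinset, mem_roots hP0, IsRoot.def]
      have hz1 : (z 1 : ℚ) ≠ 0 := by exact_mod_cast h1
      have hGq : (g₀ : ℚ) * (z 0 : ℚ) ^ 2 + 2 * (g₁ : ℚ) * z 0 * z 1 + (g₂ : ℚ) * (z 1 : ℚ) ^ 2
          = 0 := by exact_mod_cast hG z hz
      have heval : P.eval ((z 0 : ℚ) / z 1) * (z 1 : ℚ) ^ 2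
          = (g₀ : ℚ) * (z 0 : ℚ) ^ 2 + 2 * (g₁ : ℚ) * z 0 * z 1 + (g₂ : ℚ) * (z 1 : ℚ) ^ 2 := by
        simp only [hP, eval_add, eval_mul, eval_C, eval_pow, eval_X]
        field_simp
      rw [hGq] at heval
      rcases mul_eq_zero.mp heval with h | h
      · exact h
      · exact absurd (pow_eq_zero_iff two_ne_zero |>.mp h) hz1
  calc T.card ≤ 2 * (T.image φ).card := Finset.card_le_mul_card_image T 2 hfib2
    _ ≤ 2 * 3 := by
        gcongr
        calc (T.image φ).card ≤ (insert none (P.roots.toFinset.image some)).card :=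
              Finset.card_le_card himage
          _ ≤ (P.roots.toFinset.image some).card + 1 := Finset.card_insert_le _ _
          _ ≤ P.roots.toFinset.card + 1 := by gcongr; exact Finset.card_image_le
          _ ≤ 2 + 1 := by
              gcongr
              exact (Multiset.toFinset_card_le _).trans ((card_roots' P).trans hdeg)

/-- `card_le_of_plane_two` for an arbitrary pivot coordinate `k` with `a k ≠ 0`. [folklore] -/
theorem card_le_of_plane (M : Matrix (Fin 3) (Fin 3) ℤ) (hM : M.IsSymm) (hdet : M.det ≠ 0)
    (a : Fin 3 → ℤ) (k : Fin 3) (ha : a k ≠ 0) (T : Finset (Fin 3 → ℤ))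
    (hprim : ∀ z ∈ T, ∃ b : Fin 3 → ℤ, ∑ i, b i * z i = 1)
    (hF : ∀ z ∈ T, z ⬝ᵥ (M *ᵥ z) = 0)
    (hplane : ∀ z ∈ T, ∑ i, a i * z i = 0) :
    T.card ≤ 6 := by
  classical
  set σ : Equiv.Perm (Fin 3) := Equiv.swap k 2 with hσ
  have hσ2 : σ 2 = k := by simp [hσ, Equiv.swap_apply_right]
  have hcard : (T.image fun z => z ∘ σ).card = T.card :=
    Finset.card_image_of_injective _ (SquarefulDet.comp_perm_injective σ)
  rw [← hcard]
  refine card_le_of_plane_two (M.submatrix σ σ) (hM.submatrix σ)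
    (by rw [Matrix.det_submatrix_equiv_self]; exact hdet) (a ∘ σ) (by simpa [hσ2] using ha) _
    ?_ ?_ ?_
  · intro z' hz'
    obtain ⟨z, hz, rfl⟩ := Finset.mem_image.mp hz'
    obtain ⟨b, hb⟩ := hprim z hz
    exact ⟨b ∘ σ, by rw [← hb]; exact Equiv.sum_comp σ (fun i => b i * z i)⟩
  · intro z' hz'
    obtain ⟨z, hz, rfl⟩ := Finset.mem_image.mp hz'
    rw [dotProduct_mulVec_comp_perm]
    exact hF z hz
  · intro z' hz'
    obtain ⟨z, hz, rfl⟩ := Finset.mem_image.mp hz'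
    rw [← hplane z hz]
    exact Equiv.sum_comp σ (fun i => a i * z i)

/-- A set of primitive integer zeros of `xᵀ M x` (`M` symmetric, `det M ≠ 0`) any three of which
are linearly dependent has at most `6` elements. [folklore] -/
theorem card_part_le (M : Matrix (Fin 3) (Fin 3) ℤ) (hM : M.IsSymm) (hdet : M.det ≠ 0)
    (T : Finset (Fin 3 → ℤ))
    (hprim : ∀ z ∈ T, ∃ b : Fin 3 → ℤ, ∑ i, b i * z i = 1)
    (hF : ∀ z ∈ T, z ⬝ᵥ (M *ᵥ z) = 0)
    (hdep : ∀ z₁ ∈ T, ∀ z₂ ∈ T, ∀ z₃ ∈ T, (Matrix.of ![z₁, z₂, z₃]).det = 0) :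
    T.card ≤ 6 := by
  classical
  by_cases hpar : ∀ z₁ ∈ T, ∀ z₂ ∈ T, z₁ 0 * z₂ 1 = z₁ 1 * z₂ 0 ∧ z₁ 0 * z₂ 2 = z₁ 2 * z₂ 0 ∧
      z₁ 1 * z₂ 2 = z₁ 2 * z₂ 1
  · -- all elements are parallel
    rcases T.eq_empty_or_nonempty with hT | ⟨z₁, hz₁⟩
    · simp [hT]
    · calc T.card ≤ ({z₁, -z₁} : Finset (Fin 3 → ℤ)).card := by
            refine Finset.card_le_card fun z hz => ?_
            obtain ⟨h01, h02, h12⟩ := hpar z₁ hz₁ z hz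
            rcases SquarefulDet.eq_or_eq_neg_of_parallel (hprim z₁ hz₁) (hprim z hz) h01 h02 h12
              with h | h
            · simp [h]
            · simp [h]
        _ ≤ 2 := Finset.card_le_two
        _ ≤ 6 := by omega
  · simp only [not_forall] at hpar
    obtain ⟨z₁, hz₁, z₂, hz₂, hne⟩ := hpar
    -- the normal vector of the plane spanned by `z₁, z₂`
    set a : Fin 3 → ℤ := ![z₁ 1 * z₂ 2 - z₁ 2 * z₂ 1, z₁ 2 * z₂ 0 - z₁ 0 * z₂ 2,
      z₁ 0 * z₂ 1 - z₁ 1 * z₂ 0] with ha_def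
    have ha0 : a 0 = z₁ 1 * z₂ 2 - z₁ 2 * z₂ 1 := rfl
    have ha1 : a 1 = z₁ 2 * z₂ 0 - z₁ 0 * z₂ 2 := rfl
    have ha2 : a 2 = z₁ 0 * z₂ 1 - z₁ 1 * z₂ 0 := rfl
    have ha : ∃ k, a k ≠ 0 := by
      by_contra h
      simp only [not_exists, not_not] at h
      have h0 := h 0; have h1 := h 1; have h2 := h 2
      rw [ha0] at h0; rw [ha1] at h1; rw [ha2] at h2
      exact hne ⟨by linarith, by linarith, by linarith⟩
    obtain ⟨k, hk⟩ := ha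
    refine card_le_of_plane M hM hdet a k hk T hprim hF ?_
    intro z hz
    have h := hdep z hz z₁ hz₁ z₂ hz₂
    rw [Matrix.det_fin_three] at h
    simp only [Matrix.of_apply, Matrix.cons_val_zero, Matrix.cons_val_one, Matrix.cons_val_two,
      Matrix.head_cons, Matrix.tail_cons] at h
    simp only [Fin.sum_univ_three, ha0, ha1, ha2]
    linear_combination h

end TernaryConic

end Literature.NumberTheory.DiophantineGeometry
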